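import Mathlib

/-!
# The two-room law in `ℤ` (cell mm-stpp, eng-1 g5, lineage A3 «rooms»)

For finite non-empty `B, C ⊂ ℤ` and `S = B + C`:

  **`3·|B + C| ≤ |B + C − B| + |B + C − C| + 1`**  (`three_mul_card_add_le`).

No directness / TPP hypothesis is needed.  Equality holds e.g. for every pair of arithmetic progressions with a common
step and for every mixed-radix tiling pair (`C = [0,c)`, `B = c·[0,b)`), which is why the constant `3` is sharp.

Proof (ten lines on paper).  Write `ℓ_B = max B − min B`.  The room `S − B` contains the two translates `S − min B` and
`S − max B`, whose intersection is in bijection with `T_B := {s ∈ S : s + ℓ_B ∈ S}`; hence `|S − B| ≥ 2|S| − |T_B|`, and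
likewise `|S − C| ≥ 2|S| − |T_C|`.  Now `T_B + ℓ_B ⊆ S ∩ [max B + min C, ∞)` and `T_C ⊆ S ∩ (−∞, max B + min C]`: the
two ranges meet in the single pivot `max B + min C`, so `|T_B| + |T_C| ≤ |S| + 1`.

Corollary (`two_room_law_int`, the `a = 1` slice of mm-stpp-eng-1 g4's conjectured 3-ROOM LAW, torsion-free form): if
`B + C` is DIRECT (`|B + C| = |B||C|`, i.e. `(B − B) ∩ (C − C) = {0}` — for `A = {0}` this is exactly the TPP of the
triple `({0}, B, C)`), then the two rooms `|B + (C − C)|`, `|C + (B − B)|` satisfy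
`3|B||C| ≤ |B + (C − C)| + |C + (B − B)| + 1`; with the third room `|C − B| = |B||C|` the room sum of the TPP triple
`({0},B,C)` in `ℤ` is `≥ 4V − 1`, `V = |B||C|` — the value attained by the mixed-radix triples.

Evidence for the three-set analogue («`R_A + R_B + R_C ≥ |A+B+C| + |−A+B+C| + |A−B+C| + |A+B−C| − 1` in `ℤ`», TPP case
`≥ 4V − 1`): 0 violations / 6 328 equalities in 1.6·10⁵ random + exhaustive small cases, and the exact census of TPP
triples of 3-sets in `ℤ/p` (kit j273494: every prime `59 ≤ p ≤ 101` has minimum room sum exactly `4V − 1 = 107`) — NOT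
proved here.  WHAT THIS IS NOT: no statement in a finite group (the census instrument lives in `ℤ/n`; there the minimum
drops below `4V − 1` exactly when a small subgroup intervenes, e.g. `ℤ/7²`, shape `(2,2,3)`: `46 < 47`); no `ω`
statement; no census row.  [original; presearch: Tao–Vu *Additive Combinatorics* ch. 2/5, Nathanson GTM 165 ch. 1,
lit search «|A+B−B| + |A+B−A|» / «sumset of a sum with a difference set, lower bound 3|A+B|» — no source located]
-/

-- single-conjunct summit: the mandated namespace repeats `MatrixMultiplication`.
set_option linter.dupNamespace false

namespace Summit.MatrixMultiplication.MatrixMultiplication.Theorems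

namespace STPPRoomLawInt

open Finset
open scoped Pointwise

/-- Two translates inside a room: for `b, b' ∈ B` and any finite `S ⊂ ℤ`,
`2|S| ≤ |S − B| + |{s ∈ S : s + (b' − b) ∈ S}|`.  (`S − b ∪ S − b' ⊆ S − B`, and the intersection of the two
translates embeds into the overlap set by `x ↦ x + b`.) [folklore] -/
theorem two_mul_card_le_card_sub_add_card_filter (S B : Finset ℤ) {b b' : ℤ} (hb : b ∈ B) (hb' : b' ∈ B) :
    2 * S.card ≤ (S - B).card + (S.filter (fun s => s + (b' - b) ∈ S)).card := by
  classical
  set X : Finset ℤ := S.image (· - b) with hX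
  set Y : Finset ℤ := S.image (· - b') with hY
  have hXc : X.card = S.card := card_image_of_injective _ (sub_left_injective)
  have hYc : Y.card = S.card := card_image_of_injective _ (sub_left_injective)
  have hXs : X ⊆ S - B := by
    intro x hx; rw [hX, mem_image] at hx; obtain ⟨s, hs, rfl⟩ := hx; exact sub_mem_sub hs hb
  have hYs : Y ⊆ S - B := by
    intro x hx; rw [hY, mem_image] at hx; obtain ⟨s, hs, rfl⟩ := hx; exact sub_mem_sub hs hb'
  have hXY : (X ∩ Y).card ≤ (S.filter (fun s => s + (b' - b) ∈ S)).card := by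
    refine card_le_card_of_injOn (· + b) ?_ (fun x _ y _ hxy => by simpa using hxy)
    intro x hx
    rw [mem_coe, mem_inter, hX, hY, mem_image, mem_image] at hx
    obtain ⟨⟨s, hs, rfl⟩, s', hs', he⟩ := hx
    rw [mem_coe, mem_filter]
    refine ⟨?_, ?_⟩
    · show s - b + b ∈ S
      rw [sub_add_cancel]; exact hs
    · show s - b + b + (b' - b) ∈ S
      have : s - b + b + (b' - b) = s' := by rw [← he]; ring
      rw [this]; exact hs'
  have h1 : (X ∪ Y).card ≤ (S - B).card := card_le_card (union_subset hXs hYs)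
  have h2 := card_union_add_card_inter X Y
  omega

/-- Elements of a sumset `B + C ⊂ ℤ` lie between `min B + min C` and `max B + max C`. [folklore] -/
theorem mem_add_bounds {B C : Finset ℤ} (hB : B.Nonempty) (hC : C.Nonempty) {s : ℤ} (hs : s ∈ B + C) :
    B.min' hB + C.min' hC ≤ s ∧ s ≤ B.max' hB + C.max' hC := by
  rw [mem_add] at hs
  obtain ⟨b, hb, c, hc, rfl⟩ := hs
  exact ⟨add_le_add (min'_le B b hb) (min'_le C c hc), add_le_add (le_max' B b hb) (le_max' C c hc)⟩

/-- **The two-room law in `ℤ`, general form.**  For finite non-empty `B, C ⊂ ℤ`: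
`3·|B + C| ≤ |(B + C) − B| + |(B + C) − C| + 1`.  Sharp (arithmetic progressions with a common step; mixed-radix
tiling pairs). [original] -/
theorem three_mul_card_add_le (B C : Finset ℤ) (hB : B.Nonempty) (hC : C.Nonempty) :
    3 * (B + C).card ≤ ((B + C) - B).card + ((B + C) - C).card + 1 := by
  classical
  set S : Finset ℤ := B + C with hSdef
  set bm := B.min' hB with hbm
  set bM := B.max' hB with hbM
  set cm := C.min' hC with hcm
  set cM := C.max' hC with hcM
  -- overlap sets
  set TB : Finset ℤ := S.filter (fun s => s + (bM - bm) ∈ S) with hTB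
  set TC : Finset ℤ := S.filter (fun s => s + (cM - cm) ∈ S) with hTC
  have hB2 : 2 * S.card ≤ (S - B).card + TB.card :=
    two_mul_card_le_card_sub_add_card_filter S B (min'_mem B hB) (max'_mem B hB)
  have hC2 : 2 * S.card ≤ (S - C).card + TC.card :=
    two_mul_card_le_card_sub_add_card_filter S C (min'_mem C hC) (max'_mem C hC)
  -- the pivot
  set piv : ℤ := bM + cm with hpiv
  set Sup : Finset ℤ := S.filter (fun s => piv ≤ s) with hSup
  set Slo : Finset ℤ := S.filter (fun s => s ≤ piv) with hSlo
  have hTBle : TB.card ≤ Sup.card := by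
    refine card_le_card_of_injOn (· + (bM - bm)) ?_ (fun x _ y _ hxy => by simpa using hxy)
    intro s hs
    rw [mem_coe, hTB, mem_filter] at hs
    obtain ⟨hsS, hs2⟩ := hs
    rw [mem_coe, hSup, mem_filter]
    refine ⟨hs2, ?_⟩
    have := (mem_add_bounds hB hC (hSdef ▸ hsS)).1
    show bM + cm ≤ s + (bM - bm)
    linarith
  have hTCle : TC.card ≤ Slo.card := by
    refine card_le_card ?_
    intro s hs
    rw [hTC, mem_filter] at hs
    obtain ⟨hsS, hs2⟩ := hs
    rw [hSlo, mem_filter]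
    refine ⟨hsS, ?_⟩
    have := (mem_add_bounds hB hC (hSdef ▸ hs2)).2
    show s ≤ bM + cm
    linarith
  -- the two halves of S meet only at the pivot
  have hcover : Sup ∪ Slo = S := by
    ext s
    rw [mem_union, hSup, hSlo, mem_filter, mem_filter]
    constructor
    · rintro (⟨h, _⟩ | ⟨h, _⟩) <;> exact h
    · intro h
      rcases le_total piv s with h' | h'
      · exact Or.inl ⟨h, h'⟩
      · exact Or.inr ⟨h, h'⟩
  have hinter : (Sup ∩ Slo).card ≤ 1 := by
    rw [card_le_one]
    intro x hx y hy
    rw [mem_inter, hSup, hSlo, mem_filter, mem_filter] at hx hy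
    have hx' : x = piv := le_antisymm hx.2.2 hx.1.2
    have hy' : y = piv := le_antisymm hy.2.2 hy.1.2
    rw [hx', hy']
  have hsum : Sup.card + Slo.card ≤ S.card + 1 := by
    have := card_union_add_card_inter Sup Slo
    rw [hcover] at this
    omega
  omega

/-- Pointwise bookkeeping: `B + (C − C) = (B + C) − C` for finsets of an additive commutative group. [folklore] -/
theorem add_sub_eq_add_sub_self {G : Type*} [AddCommGroup G] [DecidableEq G] (B C : Finset G) :
    B + (C - C) = (B + C) - C := by
  rw [sub_eq_add_neg C C, ← add_assoc, ← sub_eq_add_neg]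

/-- **The two-room law in `ℤ`, TPP form** (the `a = 1` slice of the conjectured 3-room law, torsion-free case).
If `B + C` is direct (`|B + C| = |B|·|C|`; for the triple `({0}, B, C)` this is the triple product property), then
`3·|B|·|C| ≤ |B + (C − C)| + |C + (B − B)| + 1` — the two U14⁺ rooms of the members `B` and `C`; with the third room
`|C − B| = |B||C|` the room sum is at least `4|B||C| − 1`, the mixed-radix value. [original] -/
theorem two_room_law_int (B C : Finset ℤ) (hB : B.Nonempty) (hC : C.Nonempty)
    (hdirect : (B + C).card = B.card * C.card) :
    3 * (B.card * C.card) ≤ (B + (C - C)).card + (C + (B - B)).card + 1 := by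
  classical
  have h := three_mul_card_add_le B C hB hC
  rw [hdirect] at h
  rw [add_sub_eq_add_sub_self B C, add_sub_eq_add_sub_self C B, add_comm C B]
  omega

/-- Sharpness witness (mixed radix, `b = 2`, `c = 3`): `B = {0,3}`, `C = {0,1,2}` is direct and attains
`3·2·3 = |B + (C − C)| + |C + (B − B)| + 1` (`8 + 9 + 1`). -/
example : (({0, 3} : Finset ℤ) + (({0, 1, 2} : Finset ℤ) - ({0, 1, 2} : Finset ℤ))).card = 8 ∧
    (({0, 1, 2} : Finset ℤ) + (({0, 3} : Finset ℤ) - ({0, 3} : Finset ℤ))).card = 9 := by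
  decide

/-! ## Appendix (eng-1 g5, same session): the pivot and sub-additivity lemmas isolated, and the SAME-SIGN three-room law

For `S = A + B + C ⊂ ℤ` the three «co-rooms» `|S − A|, |S − B|, |S − C|` (all summands with the same sign; for a TPP triple these are
`|P_A + B + C|` etc., NOT the TPP rooms, whose other two letters carry opposite signs) satisfy `4|S| ≤ Σ |S − X| + 1`
(`four_mul_card_add_add_le`).  Ingredients: the pivot lemma of the main proof, isolated (`card_overlap_add_card_overlap_le`), and
super-additivity of the overlap sets `T_t = {s ∈ S : s + t ∈ S}`: `|T_s| + |T_t| ≤ |T_{s+t}| + |S|` (`card_overlap_add_le`).  The MIXED-sign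
statement (conjecture G3b of the module docstring) is what the census needs and remains open. -/

/-- Overlap set `T_t(S) = {s ∈ S : s + t ∈ S}`; super-additivity `|T_s| + |T_t| ≤ |T_{s+t}| + |S|`
(since `T_s ∩ (T_t − s) ⊆ T_{s+t}` and `T_s ∪ (T_t − s) ⊆ S − s`). [folklore] -/
theorem card_overlap_add_le (S : Finset ℤ) (s t : ℤ) :
    (S.filter (fun x => x + s ∈ S)).card + (S.filter (fun x => x + t ∈ S)).card ≤
      (S.filter (fun x => x + (s + t) ∈ S)).card + S.card := by
  classical
  set Ts : Finset ℤ := S.filter (fun x => x + s ∈ S) with hTs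
  set Tt' : Finset ℤ := (S.filter (fun x => x + t ∈ S)).image (· - s) with hTt'
  have hTt'c : Tt'.card = (S.filter (fun x => x + t ∈ S)).card := card_image_of_injective _ (sub_left_injective)
  have hinter : (Ts ∩ Tt').card ≤ (S.filter (fun x => x + (s + t) ∈ S)).card := by
    refine card_le_card ?_
    intro x hx
    rw [mem_inter, hTs, mem_filter, hTt', mem_image] at hx
    obtain ⟨⟨hxS, _⟩, y, hy, hyx⟩ := hx
    rw [mem_filter] at hy
    rw [mem_filter]
    refine ⟨hxS, ?_⟩
    have : x + (s + t) = y + t := by rw [← hyx]; ring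
    rw [this]; exact hy.2
  have hunion : (Ts ∪ Tt').card ≤ S.card := by
    have : (Ts ∪ Tt') ⊆ S.image (· - s) := by
      intro x hx
      rw [mem_union, hTs, mem_filter, hTt', mem_image] at hx
      rw [mem_image]
      rcases hx with ⟨_, hxs⟩ | ⟨y, hy, hyx⟩
      · exact ⟨x + s, hxs, by ring⟩
      · rw [mem_filter] at hy
        exact ⟨y, hy.1, hyx⟩
    exact (card_le_card this).trans (card_image_le)
  have h := card_union_add_card_inter Ts Tt'
  omega

/-- **Pivot lemma.**  For `S = B + C ⊂ ℤ` (finite, non-empty): `|T_{diam B}(S)| + |T_{diam C}(S)| ≤ |S| + 1`, because `T_{diam B} + diam B` lies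
in `S ∩ [max B + min C, ∞)` and `T_{diam C}` in `S ∩ (−∞, max B + min C]`.  (The heart of `three_mul_card_add_le`, isolated for reuse.) [original] -/
theorem card_overlap_add_card_overlap_le (B C : Finset ℤ) (hB : B.Nonempty) (hC : C.Nonempty) :
    ((B + C).filter (fun s => s + (B.max' hB - B.min' hB) ∈ B + C)).card +
      ((B + C).filter (fun s => s + (C.max' hC - C.min' hC) ∈ B + C)).card ≤ (B + C).card + 1 := by
  classical
  set S : Finset ℤ := B + C with hSdef
  set bm := B.min' hB with hbm
  set bM := B.max' hB with hbM
  set cm := C.min' hC with hcm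
  set cM := C.max' hC with hcM
  set TB : Finset ℤ := S.filter (fun s => s + (bM - bm) ∈ S) with hTB
  set TC : Finset ℤ := S.filter (fun s => s + (cM - cm) ∈ S) with hTC
  set piv : ℤ := bM + cm with hpiv
  set Sup : Finset ℤ := S.filter (fun s => piv ≤ s) with hSup
  set Slo : Finset ℤ := S.filter (fun s => s ≤ piv) with hSlo
  have hTBle : TB.card ≤ Sup.card := by
    refine card_le_card_of_injOn (· + (bM - bm)) ?_ (fun x _ y _ hxy => by simpa using hxy)
    intro s hs
    rw [mem_coe, hTB, mem_filter] at hs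
    obtain ⟨hsS, hs2⟩ := hs
    rw [mem_coe, hSup, mem_filter]
    refine ⟨hs2, ?_⟩
    have := (mem_add_bounds hB hC (hSdef ▸ hsS)).1
    show bM + cm ≤ s + (bM - bm)
    linarith
  have hTCle : TC.card ≤ Slo.card := by
    refine card_le_card ?_
    intro s hs
    rw [hTC, mem_filter] at hs
    obtain ⟨hsS, hs2⟩ := hs
    rw [hSlo, mem_filter]
    refine ⟨hsS, ?_⟩
    have := (mem_add_bounds hB hC (hSdef ▸ hs2)).2
    show s ≤ bM + cm
    linarith
  have hcover : Sup ∪ Slo = S := by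
    ext s
    rw [mem_union, hSup, hSlo, mem_filter, mem_filter]
    constructor
    · rintro (⟨h, _⟩ | ⟨h, _⟩) <;> exact h
    · intro h
      rcases le_total piv s with h' | h'
      · exact Or.inl ⟨h, h'⟩
      · exact Or.inr ⟨h, h'⟩
  have hinter : (Sup ∩ Slo).card ≤ 1 := by
    rw [card_le_one]
    intro x hx y hy
    rw [mem_inter, hSup, hSlo, mem_filter, mem_filter] at hx hy
    have hx' : x = piv := le_antisymm hx.2.2 hx.1.2
    have hy' : y = piv := le_antisymm hy.2.2 hy.1.2
    rw [hx', hy']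
  have hsum : Sup.card + Slo.card ≤ S.card + 1 := by
    have := card_union_add_card_inter Sup Slo
    rw [hcover] at this
    omega
  omega

/-- The diameter of a sumset in `ℤ`: `max (B + C) − min (B + C) = (max B − min B) + (max C − min C)`. [folklore] -/
theorem max'_add_sub_min'_add (B C : Finset ℤ) (hB : B.Nonempty) (hC : C.Nonempty) (hBC : (B + C).Nonempty) :
    (B + C).max' hBC - (B + C).min' hBC = (B.max' hB - B.min' hB) + (C.max' hC - C.min' hC) := by
  have hmax : (B + C).max' hBC = B.max' hB + C.max' hC := by
    apply le_antisymm
    · exact (mem_add_bounds hB hC (max'_mem _ hBC)).2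
    · exact le_max' _ _ (add_mem_add (max'_mem B hB) (max'_mem C hC))
  have hmin : (B + C).min' hBC = B.min' hB + C.min' hC := by
    apply le_antisymm
    · exact min'_le _ _ (add_mem_add (min'_mem B hB) (min'_mem C hC))
    · exact (mem_add_bounds hB hC (min'_mem _ hBC)).1
  rw [hmax, hmin]; ring

/-- **Same-sign three-room law in `ℤ`.**  For finite non-empty `A, B, C ⊂ ℤ` and `S = A + B + C`:
`4·|S| ≤ |S − A| + |S − B| + |S − C| + 1` (sharp for arithmetic progressions with a common step).  For a TPP triple these are the
co-rooms `|P_A + B + C|, |P_B + C + A|, |P_C + A + B|` — NOT the TPP rooms `|P_A + (B − C)|, …` of the census (conjecture G3b). [original] -/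
theorem four_mul_card_add_add_le (A B C : Finset ℤ) (hA : A.Nonempty) (hB : B.Nonempty) (hC : C.Nonempty) :
    4 * (A + B + C).card ≤ ((A + B + C) - A).card + ((A + B + C) - B).card + ((A + B + C) - C).card + 1 := by
  classical
  have hBC : (B + C).Nonempty := hB.add hC
  set S : Finset ℤ := A + B + C with hSdef
  have hS' : S = A + (B + C) := by rw [hSdef, add_assoc]
  set lA := A.max' hA - A.min' hA with hlA
  set lB := B.max' hB - B.min' hB with hlB
  set lC := C.max' hC - C.min' hC with hlC
  -- two translates per co-room
  have h1 : 2 * S.card ≤ (S - A).card + (S.filter (fun s => s + lA ∈ S)).card :=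
    two_mul_card_le_card_sub_add_card_filter S A (min'_mem A hA) (max'_mem A hA)
  have h2 : 2 * S.card ≤ (S - B).card + (S.filter (fun s => s + lB ∈ S)).card :=
    two_mul_card_le_card_sub_add_card_filter S B (min'_mem B hB) (max'_mem B hB)
  have h3 : 2 * S.card ≤ (S - C).card + (S.filter (fun s => s + lC ∈ S)).card :=
    two_mul_card_le_card_sub_add_card_filter S C (min'_mem C hC) (max'_mem C hC)
  -- super-additivity: T_B + T_C ≤ T_{B+C} + |S|
  have h4 := card_overlap_add_le S lB lC
  -- pivot on S = A + (B + C): T_A + T_{B+C} ≤ |S| + 1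
  have h5 := card_overlap_add_card_overlap_le A (B + C) hA hBC
  have hl : (B + C).max' hBC - (B + C).min' hBC = lB + lC := max'_add_sub_min'_add B C hB hC hBC
  rw [hl, ← hS', ← hlA] at h5
  omega

/-- Sharpness witness: `A = B = C = {0,1}` gives `S = {0,1,2,3}`, `|S − X| = 5` each, `4·4 = 15 + 1`. -/
example : ((({0, 1} : Finset ℤ) + {0, 1} + {0, 1}) - ({0, 1} : Finset ℤ)).card = 5 ∧
    (({0, 1} : Finset ℤ) + {0, 1} + {0, 1}).card = 4 := by
  decide

end STPPRoomLawInt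

end Summit.MatrixMultiplication.MatrixMultiplication.Theorems
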